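import Literature.ModelTheory.ExponentialFields.WilkieModelCompletenessProofs
import Literature.ModelTheory.ExponentialFields.RealExpOMinimalProofs
import Mathlib.Algebra.MvPolynomial.PDeriv
import Mathlib.Algebra.MvPolynomial.Derivation
import Mathlib.LinearAlgebra.Matrix.ToLinearEquiv
import HarnessLib

/-!
# Wilkie 1996, §9: the induction on the number of exponentials — boundedness from Lemma 9.3 alone

Topic `Literature/ModelTheory/ExponentialFields`.  The last unproved printed leaf under Wilkie's
theorem in this tree is `Literature.ModelTheory.ExponentialFields.Wilkie1996_expPolynomialPoints_bounded`
(`Wilkie1996.lean`; A. J. Wilkie, J. Amer. Math. Soc. 9 (1996), §9, p. 1083): for models `k ⊆ K`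
of `T_exp`, every non-singular zero `ᾱ ∈ Kⁿ` of a square exponential-polynomial system over `k`
is bounded in absolute value by an element of `k`.  Wilkie proves it (pp. 1084–1085) by an
induction on the number `m` of exponentials `exp(xᵢ)` occurring, working in the rings
`Mˢₙ = k[xᵢ, (1 + xᵢ²)⁻¹, e(xᵢ) (i ≤ n), exp(xᵢ) (i ∈ s)]`, `e(x) = exp((1 + x²)⁻¹)`
(den Besten 2016, Definition 6.2.5), from two ingredients: the model completeness of
`T_e = Th(ℝ; e)` (his Theorem 11.1, a case of the First Main Theorem) for the case `m = 0`, and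
**9.3** (p. 1084; proved in §§10–11 by the valuation inequality for smooth o-minimal theories),
taken here in the form of den Besten's condition (36) / Lemma 7.2.4: if `ᾱ` is a non-singular
zero of a square system from `Mˢₙ`, `l ∈ s` and `|α_l| > k`, then `0 < c + Σ_{i ∈ s} nᵢ αᵢ < 1`
for some integers `nᵢ` (`i ∈ s`), not all zero, and some `c ∈ k`.

This file proves the **induction** (the glue of §9), in a form that needs **only 9.3**:

* `Literature.ModelTheory.ExponentialFields.RealExpModel.IsMsZero f s P α`: `ᾱ ∈ Kⁿ` is a
  non-singular zero of the square system `P₁, …, Pₙ ∈ Mˢₙ` (elements of `Mˢₙ` are presented by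
  polynomials over `k` in generator symbols `xᵢ, uᵢ, vᵢ, yᵢ` standing for
  `xᵢ, (1 + xᵢ²)⁻¹, e(xᵢ), exp(xᵢ)`, the `yᵢ` only for `i ∈ s`; the Jacobian is the one of the
  derivations `∂/∂xⱼ` of `Mˢₙ`, den Besten Remark 6.2.6, here `RealExpModel.msD j`);
* `Literature.ModelTheory.ExponentialFields.RealExpModel.exists_abs_lt_of_isMsZero_of_lemma93`:
  for a pair `f : k ↪ K` satisfying 9.3 (hypothesis `h93`, stated inline), every coordinate of
  every such `ᾱ` is bounded in absolute value by an element of `k`;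
* `Literature.ModelTheory.ExponentialFields.Wilkie1996_expPolynomialPoints_bounded_of_lemma93` and
  `Literature.ModelTheory.ExponentialFields.Wilkie1996_expAlgebraicPoints_bounded_of_lemma93`: the
  printed leaf, and the hypothesis of Wilkie 1989, Theorem 2, from 9.3 for all pairs of models.

Two remarks on the printed proof, which the formalization makes precise.  (1) Wilkie refutes a
minimal counterexample `(*)ₘ` (p. 1084) and needs `T_e`'s model completeness to exclude `m = 0`;
inducting instead on configurations with `l ∈ s` (which is where exponential-polynomial points
start, `s = {1, …, n}`, and which the step preserves), the case `m = 0` never arises, so that the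
model completeness of `T_e` is used only inside the proof of 9.3 (where `k ≼ K` as `L_e`-structures
is essential).  (2) The step (pp. 1084–1085; den Besten pp. 75–77) passes from `ᾱ` to the point
`(ᾱ, exp(α₁), α_{n+2})` and the `n + 2` equations "`fᵢ` with `exp(x₁)` replaced by `x_{n+1}`",
`(1 + x²_{n+2})⁻¹ - c - Σ nᵢ xᵢ = 0` and the exponentiated relation; den Besten obtains a
non-singular square system at this point from its isolation via Proposition 6.2.7 (i), (ii)
(Wilkie's Theorems 5.1, 4.9).  Here the displayed `(n + 2) × (n + 2)` system is shown to be
non-singular directly (`RealExpModel.MsStep.det_newJac_ne_zero`: a kernel vector `w` has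
`w_{n+1} = exp(α₁) w₁` by the last two rows, and then `J(f)(ᾱ) w_{≤ n} = 0`), so no
desingularisation is needed.

Nothing here is a new named fact: 9.3 enters as an explicit hypothesis.  What is NOT here: 9.3
itself (Wilkie §§10–11: `T_e` smooth and model complete, `valdim ≤ dim`, Lemmas 11.2/7.2.2–7.2.4).

## References

* A. J. Wilkie, *Model completeness results for expansions of the ordered field of real numbers by
  restricted Pfaffian functions and the exponential function*, J. Amer. Math. Soc. 9 (1996),
  1051–1094: §9, pp. 1083–1085 (the reduction, `(*)ₘ`, 9.3, the induction step). [WilkieJAMS1996]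
* M. den Besten, *Wilkie's Theorem and the Uniform Real Schanuel Conjecture*, MSc thesis, Utrecht
  (2016): Definition 6.2.5, Remark 6.2.6, proof of Theorem 6.1.2 (pp. 75–77, (35)–(39)),
  Lemma 7.2.4 and the derivation of (36) (p. 82). [DenBesten2016]
* A. J. Wilkie, *On the theory of the real exponential field*, Illinois J. Math. 33 (1989),
  Theorem 2. [Wilkie1989]
-/

noncomputable section

open FirstOrder FirstOrder.Language FirstOrder.Language.Structure
open MvPolynomial

namespace Literature.ModelTheory.ExponentialFields

namespace RealExpModel

/-! ### The rings `Mˢₙ`: generator symbols, evaluation, derivations -/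

/-- The four kinds of generators of Wilkie's rings `Mˢₙ`: `x` (the unknown `xᵢ`), `u`
(`(1 + xᵢ²)⁻¹`), `v` (`e(xᵢ) = exp((1 + xᵢ²)⁻¹)`), `y` (`exp(xᵢ)`). [cite: DenBesten2016, Definition 6.2.5] -/
inductive MsKind
  | x
  | u
  | v
  | y
  deriving DecidableEq

/-- The generator symbols of `Mˢₙ` (all `n` indices for each kind; the restriction to `yᵢ`,
`i ∈ s`, is a support condition, `RealExpModel.MsSupported`). [cite: DenBesten2016, Definition 6.2.5] -/
abbrev MsVar (n : ℕ) : Type := MsKind × Fin n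

variable {k K : Language.Theory.ModelType.{0, 0, 0} realExpTheory}

/-- The values in `K` of the generators of `Mˢₙ` at a point `ᾱ ∈ Kⁿ`:
`xᵢ ↦ αᵢ`, `uᵢ ↦ (1 + αᵢ²)⁻¹`, `vᵢ ↦ exp((1 + αᵢ²)⁻¹)`, `yᵢ ↦ exp(αᵢ)`. [cite: DenBesten2016, Definition 6.2.5] -/
def msVal {n : ℕ} (α : Fin n → K) : MsVar n → K
  | (MsKind.x, i) => α i
  | (MsKind.u, i) => (1 + α i ^ 2)⁻¹
  | (MsKind.v, i) => exp ((1 + α i ^ 2)⁻¹)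
  | (MsKind.y, i) => exp (α i)

/-- Value of `xᵢ`. [folklore] -/
@[simp] theorem msVal_x {n : ℕ} (α : Fin n → K) (i : Fin n) : msVal α (MsKind.x, i) = α i := rfl
/-- Value of `uᵢ`. [folklore] -/
@[simp] theorem msVal_u {n : ℕ} (α : Fin n → K) (i : Fin n) :
    msVal α (MsKind.u, i) = (1 + α i ^ 2)⁻¹ := rfl
/-- Value of `vᵢ`. [folklore] -/
@[simp] theorem msVal_v {n : ℕ} (α : Fin n → K) (i : Fin n) :
    msVal α (MsKind.v, i) = exp ((1 + α i ^ 2)⁻¹) := rfl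
/-- Value of `yᵢ`. [folklore] -/
@[simp] theorem msVal_y {n : ℕ} (α : Fin n → K) (i : Fin n) :
    msVal α (MsKind.y, i) = exp (α i) := rfl

/-- **Evaluation** of (a presentation of) an element of `Mˢₙ` at `ᾱ ∈ Kⁿ` along the embedding
`f : k ↪ K` of models: the function `Kⁿ → K` it denotes (den Besten, Definition 6.2.5: "the ring of
functions `Kⁿ → K` generated over `k` by …"). [cite: DenBesten2016, Definition 6.2.5] -/
def msEval (f : k ↪[Language.orderedExpRing] K) {n : ℕ} (α : Fin n → K) :
    MvPolynomial (MsVar n) k →+* K :=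
  eval₂Hom (toRingHom f) (msVal α)

/-- Evaluation of a generator. [folklore] -/
@[simp] theorem msEval_X (f : k ↪[Language.orderedExpRing] K) {n : ℕ} (α : Fin n → K) (w : MsVar n) :
    msEval f α (X w) = msVal α w := by
  simp [msEval]

/-- Evaluation of a constant from `k`. [folklore] -/
@[simp] theorem msEval_C (f : k ↪[Language.orderedExpRing] K) {n : ℕ} (α : Fin n → K) (c : k) :
    msEval f α (C c) = f c := by
  simp [msEval]

/-- The directions of the derivation `∂/∂xⱼ` on the generators of `Mˢₙ`:
`∂xᵢ/∂xⱼ = δᵢⱼ`, `∂uⱼ/∂xⱼ = -2 xⱼ uⱼ²`, `∂vⱼ/∂xⱼ = -2 xⱼ uⱼ² vⱼ`, `∂yⱼ/∂xⱼ = yⱼ` (den Besten,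
Remark 6.2.6: "the derivatives of each of the generators of `Mˢₙ` lie in `Mˢₙ`"). [cite: DenBesten2016, Remark 6.2.6] -/
def msDir {n : ℕ} (j : Fin n) : MsVar n → MvPolynomial (MsVar n) k
  | (MsKind.x, i) => if i = j then 1 else 0
  | (MsKind.u, i) => if i = j then C (-2) * X (MsKind.x, j) * X (MsKind.u, j) ^ 2 else 0
  | (MsKind.v, i) =>
    if i = j then C (-2) * X (MsKind.x, j) * X (MsKind.u, j) ^ 2 * X (MsKind.v, j) else 0
  | (MsKind.y, i) => if i = j then X (MsKind.y, j) else 0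

/-- **The derivation `∂/∂xⱼ` of `Mˢₙ`** (den Besten, Remark 6.2.6), on presentations: the unique
`k`-derivation of the polynomial ring extending `RealExpModel.msDir j`. [cite: DenBesten2016, Remark 6.2.6] -/
def msD (k : Language.Theory.ModelType.{0, 0, 0} realExpTheory) {n : ℕ} (j : Fin n) :
    Derivation k (MvPolynomial (MsVar n) k) (MvPolynomial (MsVar n) k) :=
  mkDerivation k (msDir j)

/-- `∂/∂xⱼ` of a generator. [folklore] -/
@[simp] theorem msD_X {n : ℕ} (j : Fin n) (w : MsVar n) :
    msD k j (X w : MvPolynomial (MsVar n) k) = msDir j w :=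
  mkDerivation_X _ _ _

/-- `∂/∂xⱼ` of a constant. [folklore] -/
@[simp] theorem msD_C {n : ℕ} (j : Fin n) (c : k) :
    msD k j (C c : MvPolynomial (MsVar n) k) = 0 :=
  derivation_C _ _

/-- The support condition defining `Mˢₙ` inside the polynomial ring on all generator symbols:
only the `yᵢ` with `i ∈ s` occur. [cite: DenBesten2016, Definition 6.2.5] -/
def MsSupported {n : ℕ} (s : Finset (Fin n)) (P : MvPolynomial (MsVar n) k) : Prop :=
  ∀ w ∈ P.vars, w.1 = MsKind.y → w.2 ∈ s

/-- **`ᾱ ∈ Kⁿ` is a non-singular zero of the square system `P₁, …, Pₙ ∈ Mˢₙ` over `k`**: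
`Pᵢ ∈ Mˢₙ`, `P₁(ᾱ) = ⋯ = Pₙ(ᾱ) = 0` and `det (∂(P₁, …, Pₙ)/∂(x₁, …, xₙ))(ᾱ) ≠ 0` — the
configurations of Wilkie's `(*)ₘ` (p. 1084) and den Besten's (35). [cite: WilkieJAMS1996, §9, (*)ₘ, p. 1084] -/
def IsMsZero (f : k ↪[Language.orderedExpRing] K) {n : ℕ} (s : Finset (Fin n))
    (P : Fin n → MvPolynomial (MsVar n) k) (α : Fin n → K) : Prop :=
  (∀ i, MsSupported s (P i)) ∧ (∀ i, msEval f α (P i) = 0) ∧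
    (Matrix.of fun i j => msEval f α (msD k j (P i))).det ≠ 0

/-- Enlarging `s` keeps a non-singular zero of a system from `Mˢₙ` one of a system from `Mˢ'ₙ`
(`Mˢₙ ⊆ Mˢ'ₙ` for `s ⊆ s'`). [folklore] -/
theorem IsMsZero.mono (f : k ↪[Language.orderedExpRing] K) {n : ℕ} {s s' : Finset (Fin n)}
    (hss' : s ⊆ s') {P : Fin n → MvPolynomial (MsVar n) k} {α : Fin n → K}
    (h : IsMsZero f s P α) : IsMsZero f s' P α :=
  ⟨fun i w hw hy => hss' (h.1 i w hw hy), h.2.1, h.2.2⟩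


/-! ### Generic identities for derivations of polynomial rings -/

section DerivationLemmas

variable {σ τ : Type} {A : Type*} [CommRing A] [Algebra k A]

/-- A derivation after a renaming of variables is determined by its values on the renamed
variables: if `D' (X (g w)) = rename g (D (X w))` for all `w` then `D' ∘ rename g = rename g ∘ D`.
[folklore] -/
theorem derivation_rename_eq (g : σ → τ)
    (D' : Derivation k (MvPolynomial τ k) (MvPolynomial τ k))
    (D : Derivation k (MvPolynomial σ k) (MvPolynomial σ k))
    (h : ∀ w, D' (X (g w)) = rename g (D (X w))) (Q : MvPolynomial σ k) :
    D' (rename g Q) = rename g (D Q) := by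
  induction Q using MvPolynomial.induction_on with
  | C a => simp
  | add p q hp hq => simp [hp, hq]
  | mul_X p w hp =>
    simp only [_root_.map_mul, rename_X, Derivation.leibniz, smul_eq_mul, _root_.map_add, hp, h w]

/-- **Euler's identity for a power**: if `D a = ε a` then `D (aᵐ) = m ε aᵐ`. [folklore] -/
theorem derivation_pow_of_eq (D : Derivation k A A) {a ε : A} (h : D a = ε * a) (m : ℕ) :
    D (a ^ m) = (m : A) * ε * a ^ m := by
  induction m with
  | zero => simp
  | succ m ih =>
    rw [pow_succ, Derivation.leibniz, ih, h, smul_eq_mul, smul_eq_mul]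
    push_cast
    ring

/-- **Euler's identity for a product**: if `D (g i) = ε i · g i` for `i ∈ T` then
`D (∏_{i ∈ T} g i) = (∑_{i ∈ T} ε i) ∏_{i ∈ T} g i`. [folklore] -/
theorem derivation_prod_of_eq {ι : Type} [DecidableEq ι] (D : Derivation k A A) (T : Finset ι)
    {g ε : ι → A} (h : ∀ i ∈ T, D (g i) = ε i * g i) :
    D (∏ i ∈ T, g i) = (∑ i ∈ T, ε i) * ∏ i ∈ T, g i := by
  induction T using Finset.induction_on with
  | empty => simp
  | insert a T ha ih =>
    rw [Finset.prod_insert ha, Finset.sum_insert ha, Derivation.leibniz, smul_eq_mul, smul_eq_mul,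
      ih (fun i hi => h i (Finset.mem_insert_of_mem hi)), h a (Finset.mem_insert_self a T)]
    ring

end DerivationLemmas

/-! ### `∂/∂xⱼ` split along `yⱼ` -/

/-- The directions of `∂/∂xⱼ` with the `yⱼ`-direction removed (treating `yⱼ` as an independent
symbol). [folklore] -/
def msDirX {n : ℕ} (j : Fin n) : MsVar n → MvPolynomial (MsVar n) k
  | (MsKind.y, _) => 0
  | w => msDir j w

/-- The derivation of `RealExpModel.msDirX`. [folklore] -/
def msDX (k : Language.Theory.ModelType.{0, 0, 0} realExpTheory) {n : ℕ} (j : Fin n) :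
    Derivation k (MvPolynomial (MsVar n) k) (MvPolynomial (MsVar n) k) :=
  mkDerivation k (msDirX j)

/-- The `y`-truncated derivation on a generator. [folklore] -/
@[simp] theorem msDX_X {n : ℕ} (j : Fin n) (w : MsVar n) :
    msDX k j (X w : MvPolynomial (MsVar n) k) = msDirX j w :=
  mkDerivation_X _ _ _

/-- `∂/∂xⱼ = (∂/∂xⱼ)|_{yⱼ fixed} + yⱼ ∂/∂yⱼ` (the chain rule `∂ exp(xⱼ)/∂xⱼ = exp(xⱼ)`).
[cite: DenBesten2016, Remark 6.2.6] -/
theorem msD_eq_msDX_add {n : ℕ} (j : Fin n) (Q : MvPolynomial (MsVar n) k) :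
    msD k j Q = msDX k j Q + X (MsKind.y, j) * pderiv (MsKind.y, j) Q := by
  classical
  induction Q using MvPolynomial.induction_on with
  | C a => simp
  | add p q hp hq => simp only [_root_.map_add, hp, hq]; ring
  | mul_X p w hp =>
    simp only [Derivation.leibniz, hp, smul_eq_mul, msD_X, msDX_X, pderiv_X]
    rcases w with ⟨κ, i⟩
    cases κ <;> by_cases hij : i = j
    all_goals simp [msDir, msDirX, hij]
    all_goals ring


/-- The support condition from membership in the subalgebra on the allowed generators. [folklore] -/
theorem msSupported_of_mem_supported {n : ℕ} {s : Finset (Fin n)} {Q : MvPolynomial (MsVar n) k}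
    (h : Q ∈ supported k {w : MsVar n | w.1 = MsKind.y → w.2 ∈ s}) : MsSupported s Q := by
  rw [mem_supported] at h
  intro w hw hy
  exact h hw hy

/-! ### Exponential identities in a model -/

/-- `exp (∑ g) = ∏ exp g`. [folklore] -/
theorem exp_sum {ι : Type} (T : Finset ι) (g : ι → K) : exp (∑ i ∈ T, g i) = ∏ i ∈ T, exp (g i) := by
  classical
  induction T using Finset.induction_on with
  | empty => simp
  | insert a T ha ih => rw [Finset.sum_insert ha, Finset.prod_insert ha, exp_add, ih]

/-- `exp (m a) = (exp a)ᵐ`. [folklore] -/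
theorem exp_natCast_mul (m : ℕ) (a : K) : exp ((m : K) * a) = exp a ^ m := by
  induction m with
  | zero => simp
  | succ m ih => rw [Nat.cast_succ, add_mul, one_mul, exp_add, ih, pow_succ]

/-- `exp (-a) = (exp a)⁻¹`. [folklore] -/
theorem exp_neg' (a : K) : exp (-a) = (exp a)⁻¹ := by
  have h : exp (-a) * exp a = 1 := by rw [← exp_add, neg_add_cancel, exp_zero]
  exact eq_inv_of_mul_eq_one_left h

/-- `exp a ≠ 0`. [folklore] -/
theorem exp_ne_zero (a : K) : exp a ≠ 0 := (exp_pos a).ne'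

/-- The multiplicative form of an integer relation: with `pzᵢ = exp(αᵢ)^{nᵢ⁺}` and
`nzᵢ = exp(αᵢ)^{nᵢ⁻}`, `exp(Σ nᵢ αᵢ) · ∏ nzᵢ = ∏ pzᵢ`. [folklore] -/
theorem exp_sum_intCast_mul {n : ℕ} (ν : Fin n → ℤ) (α : Fin n → K) :
    exp (∑ i, (ν i : K) * α i) * ∏ i, exp (α i) ^ (-ν i).toNat = ∏ i, exp (α i) ^ (ν i).toNat := by
  rw [exp_sum, ← Finset.prod_mul_distrib]
  refine Finset.prod_congr rfl fun i _ => ?_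
  rcases le_or_gt 0 (ν i) with hi | hi
  · have h1 : (-ν i).toNat = 0 := Int.toNat_eq_zero.2 (by omega)
    have h2 : ((ν i).toNat : K) = (ν i : K) := by exact_mod_cast Int.toNat_of_nonneg hi
    rw [h1, pow_zero, mul_one, ← h2, exp_natCast_mul]
  · have h1 : (ν i).toNat = 0 := Int.toNat_eq_zero.2 hi.le
    have h2 : (((-ν i).toNat : ℕ) : K) = -(ν i : K) := by
      have : (((-ν i).toNat : ℕ) : ℤ) = -ν i := Int.toNat_of_nonneg (by omega)
      exact_mod_cast this
    rw [h1, pow_zero, ← exp_natCast_mul, ← exp_add, h2]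
    simp

/-! ### The induction step: the new system in `n + 2` unknowns (den Besten (37)–(39)) -/

namespace MsStep

variable {n : ℕ}

/-- Renaming of generators: `y_{i₁} ↦ x_{n+1}` (index `zIdx n`), the other generators keep their
kind with index `castAdd 2 i` ("the result of replacing `exp(x₁)` by `x_{n+1}` in `fᵢ`", den
Besten p. 75). [cite: DenBesten2016, proof of Theorem 6.1.2, (37)] -/
def ρ (i₁ : Fin n) : MsVar n → MsVar (n + 2)
  | (MsKind.x, i) => (MsKind.x, Fin.castAdd 2 i)
  | (MsKind.u, i) => (MsKind.u, Fin.castAdd 2 i)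
  | (MsKind.v, i) => (MsKind.v, Fin.castAdd 2 i)
  | (MsKind.y, i) => if i = i₁ then (MsKind.x, zIdx n) else (MsKind.y, Fin.castAdd 2 i)

/-- `s⁺ = {j ∈ s | j ≠ i₁, nⱼ > 0}`. [cite: DenBesten2016, proof of Theorem 6.1.2, (39)] -/
def sPlus (s : Finset (Fin n)) (i₁ : Fin n) (ν : Fin n → ℤ) : Finset (Fin n) :=
  s.filter fun j => j ≠ i₁ ∧ 0 < ν j

/-- `s⁻ = {j ∈ s | nⱼ < 0}`. [cite: DenBesten2016, proof of Theorem 6.1.2, (39)] -/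
def sMinus (s : Finset (Fin n)) (ν : Fin n → ℤ) : Finset (Fin n) :=
  s.filter fun j => ν j < 0

/-- A product of powers of the generators `y_j` (old indices). [folklore] -/
def yProd (k : Language.Theory.ModelType.{0, 0, 0} realExpTheory) (T : Finset (Fin n))
    (m : Fin n → ℕ) : MvPolynomial (MsVar (n + 2)) k :=
  ∏ j ∈ T, X (MsKind.y, Fin.castAdd 2 j) ^ m j

/-- Equation (38): `u_{n+2} - c - Σᵢ nᵢ xᵢ` (`u_{n+2}` standing for `(1 + x²_{n+2})⁻¹`). [cite: DenBesten2016, proof of Theorem 6.1.2, (38)] -/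
def relPoly (ν : Fin n → ℤ) (c : k) : MvPolynomial (MsVar (n + 2)) k :=
  X (MsKind.u, yIdx n) - C c - ∑ i : Fin n, C ((ν i : ℤ) : k) * X (MsKind.x, Fin.castAdd 2 i)

/-- The left side of (39): `x_{n+1}^{n₁} · exp(c) · ∏_{j ∈ s⁺} yⱼ^{nⱼ}`. [cite: DenBesten2016, proof of Theorem 6.1.2, (39)] -/
def lhsPoly (s : Finset (Fin n)) (i₁ : Fin n) (ν : Fin n → ℤ) (c : k) : MvPolynomial (MsVar (n + 2)) k :=
  X (MsKind.x, zIdx n) ^ (ν i₁).toNat * (C (exp c) * yProd k (sPlus s i₁ ν) fun j => (ν j).toNat)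

/-- The right side of (39): `v_{n+2} · ∏_{j ∈ s⁻} yⱼ^{-nⱼ}` (`v_{n+2}` standing for `e(x_{n+2})`). [cite: DenBesten2016, proof of Theorem 6.1.2, (39)] -/
def rhsPoly (s : Finset (Fin n)) (ν : Fin n → ℤ) : MvPolynomial (MsVar (n + 2)) k :=
  X (MsKind.v, yIdx n) * yProd k (sMinus s ν) fun j => (-ν j).toNat

/-- Equation (39). [cite: DenBesten2016, proof of Theorem 6.1.2, (39)] -/
def expPoly (s : Finset (Fin n)) (i₁ : Fin n) (ν : Fin n → ℤ) (c : k) : MvPolynomial (MsVar (n + 2)) k :=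
  lhsPoly s i₁ ν c - rhsPoly s ν

/-- **The new square system (37)–(39)** in the unknowns `x₁, …, xₙ, x_{n+1}, x_{n+2}`. [cite: DenBesten2016, proof of Theorem 6.1.2, (37)–(39)] -/
def newSys (s : Finset (Fin n)) (P : Fin n → MvPolynomial (MsVar n) k) (i₁ : Fin n) (ν : Fin n → ℤ)
    (c : k) : Fin (n + 2) → MvPolynomial (MsVar (n + 2)) k :=
  Fin.append (fun i => rename (ρ i₁) (P i)) ![relPoly ν c, expPoly s i₁ ν c]

/-- **The new point** `(ᾱ, exp(α_{i₁}), β)`. [cite: DenBesten2016, proof of Theorem 6.1.2] -/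
def newPt (α : Fin n → K) (i₁ : Fin n) (β : K) : Fin (n + 2) → K :=
  Fin.append α ![exp (α i₁), β]

/-- **The new exponent set** `s ∖ {i₁}` (old indices embedded). [cite: DenBesten2016, proof of Theorem 6.1.2] -/
def newS (s : Finset (Fin n)) (i₁ : Fin n) : Finset (Fin (n + 2)) :=
  (s.erase i₁).map (Fin.castAddEmb 2)

section Basic

variable (s : Finset (Fin n)) (P : Fin n → MvPolynomial (MsVar n) k) (i₁ : Fin n) (ν : Fin n → ℤ)
  (c : k) (α : Fin n → K) (β : K)

/-- Old coordinates of the new point. [folklore] -/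
@[simp] theorem newPt_castAdd (i : Fin n) : newPt α i₁ β (Fin.castAdd 2 i) = α i := by
  simp [newPt]

/-- Coordinate `n + 1` of the new point: `exp(α_{i₁})`. [folklore] -/
@[simp] theorem newPt_zIdx : newPt α i₁ β (zIdx n) = exp (α i₁) := by
  rw [← natAdd_zero_eq_zIdx, newPt, Fin.append_right]; rfl

/-- Coordinate `n + 2` of the new point: `β`. [folklore] -/
@[simp] theorem newPt_yIdx : newPt α i₁ β (yIdx n) = β := by
  rw [← natAdd_one_eq_yIdx, newPt, Fin.append_right]; rfl

/-- Old equations of the new system: the renamed `Pᵢ` (37). [folklore] -/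
@[simp] theorem newSys_castAdd (i : Fin n) : newSys s P i₁ ν c (Fin.castAdd 2 i) = rename (ρ i₁) (P i) := by
  simp [newSys]

/-- Equation `n + 1` of the new system: (38). [folklore] -/
@[simp] theorem newSys_zIdx : newSys s P i₁ ν c (zIdx n) = relPoly ν c := by
  rw [← natAdd_zero_eq_zIdx, newSys, Fin.append_right]; rfl

/-- Equation `n + 2` of the new system: (39). [folklore] -/
@[simp] theorem newSys_yIdx : newSys s P i₁ ν c (yIdx n) = expPoly s i₁ ν c := by
  rw [← natAdd_one_eq_yIdx, newSys, Fin.append_right]; rfl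

/-- Membership in the new exponent set. [folklore] -/
theorem castAdd_mem_newS {j : Fin n} : Fin.castAdd 2 j ∈ newS s i₁ ↔ j ∈ s ∧ j ≠ i₁ := by
  simp only [newS, Finset.mem_map, Finset.mem_erase, Fin.castAddEmb_apply, Fin.castAdd_inj]
  constructor
  · rintro ⟨j', ⟨hne, hmem⟩, rfl⟩; exact ⟨hmem, hne⟩
  · rintro ⟨hmem, hne⟩; exact ⟨j, ⟨hne, hmem⟩, rfl⟩

/-- Elements of the new exponent set are old indices. [folklore] -/
theorem exists_of_mem_newS {j' : Fin (n + 2)} (h : j' ∈ newS s i₁) :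
    ∃ j, j ∈ s ∧ j ≠ i₁ ∧ j' = Fin.castAdd 2 j := by
  simp only [newS, Finset.mem_map, Finset.mem_erase, Fin.castAddEmb_apply] at h
  obtain ⟨j, ⟨hne, hmem⟩, rfl⟩ := h
  exact ⟨j, hmem, hne, rfl⟩

/-- The new exponent set has one element less. [folklore] -/
theorem card_newS (hi₁ : i₁ ∈ s) : (newS s i₁).card = s.card - 1 := by
  rw [newS, Finset.card_map, Finset.card_erase_of_mem hi₁]

/-- The new point realizes the renamed generators as the old point realizes the old ones. [folklore] -/
theorem msVal_newPt_ρ (w : MsVar n) : msVal (newPt α i₁ β) (ρ i₁ w) = msVal α w := by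
  rcases w with ⟨κ, i⟩
  cases κ
  · simp [ρ]
  · simp [ρ]
  · simp [ρ]
  · by_cases h : i = i₁
    · subst h; simp [ρ]
    · simp [ρ, h]

/-- Evaluating a renamed element of `Mˢₙ` at the new point. [folklore] -/
theorem msEval_newPt_rename (f : k ↪[Language.orderedExpRing] K) (Q : MvPolynomial (MsVar n) k) :
    msEval f (newPt α i₁ β) (rename (ρ i₁) Q) = msEval f α Q := by
  have h : msVal (newPt α i₁ β) ∘ ρ i₁ = msVal α := funext (msVal_newPt_ρ i₁ α β)
  rw [msEval, msEval, eval₂Hom_rename, h]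

/-- Renamed elements of `Mˢₙ` lie in `M^{s'}_{n+2}`. [folklore] -/
theorem msSupported_rename {Q : MvPolynomial (MsVar n) k} (hQ : MsSupported s Q) :
    MsSupported (newS s i₁) (rename (ρ i₁) Q) := by
  classical
  intro w hw hy
  obtain ⟨w₀, hw₀, rfl⟩ := Finset.mem_image.1 (vars_rename (ρ i₁) Q hw)
  rcases w₀ with ⟨κ, i⟩
  cases κ
  · simp [ρ] at hy
  · simp [ρ] at hy
  · simp [ρ] at hy
  · by_cases h : i = i₁
    · subst h; simp [ρ] at hy
    · have hi : i ∈ s := hQ _ hw₀ rfl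
      simp only [ρ, h, ↓reduceIte] at hy ⊢
      exact (castAdd_mem_newS s i₁).2 ⟨hi, h⟩

/-- The allowed generators of `M^{s'}_{n+2}` as a set. [folklore] -/
theorem X_mem_supported_of_ne {w : MsVar (n + 2)} (hw : w.1 ≠ MsKind.y) :
    (X w : MvPolynomial (MsVar (n + 2)) k) ∈
      supported k {w : MsVar (n + 2) | w.1 = MsKind.y → w.2 ∈ newS s i₁} := by
  rw [X_mem_supported]
  intro h
  exact (hw h).elim

/-- `y_j`, `j ∈ s ∖ {i₁}`, is an allowed generator of `M^{s'}_{n+2}`. [folklore] -/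
theorem X_y_mem_supported {j : Fin n} (hj : j ∈ s) (hji : j ≠ i₁) :
    (X (MsKind.y, Fin.castAdd 2 j) : MvPolynomial (MsVar (n + 2)) k) ∈
      supported k {w : MsVar (n + 2) | w.1 = MsKind.y → w.2 ∈ newS s i₁} := by
  rw [X_mem_supported]
  intro _
  exact (castAdd_mem_newS s i₁).2 ⟨hj, hji⟩

/-- A product of powers of allowed `y_j` is allowed. [folklore] -/
theorem yProd_mem_supported {T : Finset (Fin n)} (hT : ∀ j ∈ T, j ∈ s ∧ j ≠ i₁) (m : Fin n → ℕ) :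
    yProd k T m ∈ supported k {w : MsVar (n + 2) | w.1 = MsKind.y → w.2 ∈ newS s i₁} := by
  refine Subalgebra.prod_mem _ fun j hj => Subalgebra.pow_mem _ ?_ _
  exact X_y_mem_supported s i₁ (hT j hj).1 (hT j hj).2

/-- Equation (38) lies in `M^{s'}_{n+2}`. [folklore] -/
theorem msSupported_relPoly : MsSupported (newS s i₁) (relPoly ν c : MvPolynomial (MsVar (n + 2)) k) := by
  refine msSupported_of_mem_supported ?_
  refine Subalgebra.sub_mem _ (Subalgebra.sub_mem _ ?_ ?_) (Subalgebra.sum_mem _ fun i _ => ?_)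
  · exact X_mem_supported_of_ne s i₁ (by simp)
  · rw [← MvPolynomial.algebraMap_eq]; exact Subalgebra.algebraMap_mem _ _
  · refine Subalgebra.mul_mem _ ?_ (X_mem_supported_of_ne s i₁ (by simp))
    rw [← MvPolynomial.algebraMap_eq]; exact Subalgebra.algebraMap_mem _ _

/-- Equation (39) lies in `M^{s'}_{n+2}` (when `n_{i₁} > 0`, so that `i₁ ∉ s⁻`). [folklore] -/
theorem msSupported_expPoly (hpos : 0 < ν i₁) :
    MsSupported (newS s i₁) (expPoly s i₁ ν c : MvPolynomial (MsVar (n + 2)) k) := by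
  refine msSupported_of_mem_supported (Subalgebra.sub_mem _ ?_ ?_)
  · refine Subalgebra.mul_mem _ (Subalgebra.pow_mem _ (X_mem_supported_of_ne s i₁ (by simp)) _)
      (Subalgebra.mul_mem _ ?_ (yProd_mem_supported s i₁ (fun j hj => ?_) _))
    · rw [← MvPolynomial.algebraMap_eq]; exact Subalgebra.algebraMap_mem _ _
    · simp only [sPlus, Finset.mem_filter] at hj
      exact ⟨hj.1, hj.2.1⟩
  · refine Subalgebra.mul_mem _ (X_mem_supported_of_ne s i₁ (by simp))
      (yProd_mem_supported s i₁ (fun j hj => ?_) _)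
    simp only [sMinus, Finset.mem_filter] at hj
    refine ⟨hj.1, fun h => ?_⟩
    rw [h] at hj
    exact lt_asymm hpos hj.2

end Basic


section Values

variable (f : k ↪[Language.orderedExpRing] K) (s : Finset (Fin n)) (P : Fin n → MvPolynomial (MsVar n) k)
  (i₁ : Fin n) (ν : Fin n → ℤ) (c : k) (α : Fin n → K) (β : K)

/-- `f` on integers. [folklore] -/
@[simp] theorem map_intCast' (m : ℤ) : f (m : k) = (m : K) := by
  rw [← coe_toRingHom f]; exact map_intCast (toRingHom f) m

/-- `f` on naturals. [folklore] -/
@[simp] theorem map_natCast' (m : ℕ) : f (m : k) = (m : K) := by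
  rw [← coe_toRingHom f]; exact map_natCast (toRingHom f) m

/-- `f` on numerals. [folklore] -/
@[simp] theorem map_ofNat' (m : ℕ) [m.AtLeastTwo] :
    f (no_index (OfNat.ofNat m) : k) = (OfNat.ofNat m : K) := by
  rw [← coe_toRingHom f]; exact map_ofNat (toRingHom f) m

/-- Value of a `y`-product at the new point. [folklore] -/
@[simp] theorem msEval_yProd (T : Finset (Fin n)) (m : Fin n → ℕ) :
    msEval f (newPt α i₁ β) (yProd k T m) = ∏ j ∈ T, exp (α j) ^ m j := by
  simp [yProd, map_prod]

/-- Value of the left side of (39) at the new point. [folklore] -/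
theorem msEval_lhsPoly : msEval f (newPt α i₁ β) (lhsPoly s i₁ ν c) =
    exp (α i₁) ^ (ν i₁).toNat * (exp (f c) * ∏ j ∈ sPlus s i₁ ν, exp (α j) ^ (ν j).toNat) := by
  simp [lhsPoly]

/-- Value of the right side of (39) at the new point. [folklore] -/
theorem msEval_rhsPoly : msEval f (newPt α i₁ β) (rhsPoly s ν) =
    exp ((1 + β ^ 2)⁻¹) * ∏ j ∈ sMinus s ν, exp (α j) ^ (-ν j).toNat := by
  simp [rhsPoly]

/-- (38) holds at the new point when `(1 + β²)⁻¹ = c + Σ nᵢ αᵢ`. [cite: DenBesten2016, proof of Theorem 6.1.2, (38)] -/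
theorem msEval_relPoly (hβ : (1 + β ^ 2)⁻¹ = f c + ∑ i, (ν i : K) * α i) :
    msEval f (newPt α i₁ β) (relPoly ν c) = 0 := by
  simp [relPoly, map_sum, hβ]

variable {s i₁ ν}

/-- The positive part of the exponentiated relation collects `i₁` and `s⁺`. [folklore] -/
theorem prod_toNat_eq (hν0 : ∀ i, i ∉ s → ν i = 0) (hpos : 0 < ν i₁) :
    ∏ i, exp (α i) ^ (ν i).toNat =
      exp (α i₁) ^ (ν i₁).toNat * ∏ j ∈ sPlus s i₁ ν, exp (α j) ^ (ν j).toNat := by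
  classical
  have hi₁ : i₁ ∉ sPlus s i₁ ν := by simp [sPlus]
  have hins : ∏ j ∈ insert i₁ (sPlus s i₁ ν), exp (α j) ^ (ν j).toNat =
      exp (α i₁) ^ (ν i₁).toNat * ∏ j ∈ sPlus s i₁ ν, exp (α j) ^ (ν j).toNat :=
    Finset.prod_insert hi₁
  rw [← hins]
  refine (Finset.prod_subset (Finset.subset_univ _) fun i _ hi => ?_).symm
  have h0 : (ν i).toNat = 0 := by
    rw [Int.toNat_eq_zero]
    by_contra hlt
    push Not at hlt
    have his : i ∈ s := by
      by_contra h'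
      exact absurd (hν0 i h') (ne_of_gt hlt)
    have hne : i ≠ i₁ := by rintro rfl; simp at hi
    exact hi (Finset.mem_insert_of_mem (by simp [sPlus, his, hne, hlt]))
  rw [h0, pow_zero]

/-- The negative part of the exponentiated relation collects `s⁻`. [folklore] -/
theorem prod_toNat_neg_eq (hν0 : ∀ i, i ∉ s → ν i = 0) :
    ∏ i, exp (α i) ^ (-ν i).toNat = ∏ j ∈ sMinus s ν, exp (α j) ^ (-ν j).toNat := by
  classical
  refine (Finset.prod_subset (Finset.subset_univ _) fun i _ hi => ?_).symm
  have h0 : (-ν i).toNat = 0 := by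
    rw [Int.toNat_eq_zero]
    by_contra hlt
    push Not at hlt
    have his : i ∈ s := by
      by_contra h'
      have := hν0 i h'
      omega
    exact hi (by simp [sMinus, his]; omega)
  rw [h0, pow_zero]

/-- **(39) holds at the new point**: exponentiating `(1 + β²)⁻¹ = c + Σ nᵢ αᵢ` gives
`exp(α_{i₁})^{n₁} e^c ∏_{s⁺} exp(αⱼ)^{nⱼ} = e(β) ∏_{s⁻} exp(αⱼ)^{-nⱼ}`. [cite: DenBesten2016, proof of Theorem 6.1.2, (39)] -/
theorem msEval_lhsPoly_eq_rhsPoly (hν0 : ∀ i, i ∉ s → ν i = 0) (hpos : 0 < ν i₁)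
    (hβ : (1 + β ^ 2)⁻¹ = f c + ∑ i, (ν i : K) * α i) :
    msEval f (newPt α i₁ β) (lhsPoly s i₁ ν c) = msEval f (newPt α i₁ β) (rhsPoly s ν) := by
  have key := exp_sum_intCast_mul ν α
  rw [prod_toNat_eq α hν0 hpos, prod_toNat_neg_eq α hν0] at key
  rw [msEval_lhsPoly, msEval_rhsPoly, hβ, exp_add, mul_assoc, key]
  ring

/-- (39) holds at the new point. [cite: DenBesten2016, proof of Theorem 6.1.2, (39)] -/
theorem msEval_expPoly (hν0 : ∀ i, i ∉ s → ν i = 0) (hpos : 0 < ν i₁)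
    (hβ : (1 + β ^ 2)⁻¹ = f c + ∑ i, (ν i : K) * α i) :
    msEval f (newPt α i₁ β) (expPoly s i₁ ν c) = 0 := by
  rw [expPoly, _root_.map_sub, msEval_lhsPoly_eq_rhsPoly f c α β hν0 hpos hβ, sub_self]

end Values

section Derivatives

variable (i₁ : Fin n)

/-- `∂/∂xⱼ` (`j ≠ i₁` old) commutes with the renaming. [folklore] -/
theorem msD_rename_castAdd_of_ne {j : Fin n} (hj : j ≠ i₁) (Q : MvPolynomial (MsVar n) k) :
    msD k (Fin.castAdd 2 j) (rename (ρ i₁) Q) = rename (ρ i₁) (msD k j Q) := by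
  refine derivation_rename_eq (ρ i₁) _ _ (fun w => ?_) Q
  rw [msD_X, msD_X]
  rcases w with ⟨κ, i⟩
  cases κ
  · by_cases hij : i = j <;> simp [ρ, msDir, hij]
  · by_cases hij : i = j
    · subst hij; simp [ρ, msDir]
    · simp [ρ, msDir, hij]
  · by_cases hij : i = j
    · subst hij; simp [ρ, msDir]
    · simp [ρ, msDir, hij]
  · by_cases hi : i = i₁
    · subst hi
      simp [ρ, msDir, hj.symm, (castAdd_ne_zIdx j).symm]
    · by_cases hij : i = j
      · subst hij; simp [ρ, msDir, hi]
      · simp [ρ, msDir, hij, hi]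

/-- `∂/∂x_{i₁}` after the renaming is the renaming of `∂/∂x_{i₁}` with `y_{i₁}` held fixed. [folklore] -/
theorem msD_rename_castAdd_self (Q : MvPolynomial (MsVar n) k) :
    msD k (Fin.castAdd 2 i₁) (rename (ρ i₁) Q) = rename (ρ i₁) (msDX k i₁ Q) := by
  refine derivation_rename_eq (ρ i₁) _ _ (fun w => ?_) Q
  rw [msD_X, msDX_X]
  rcases w with ⟨κ, i⟩
  cases κ
  · by_cases hij : i = i₁ <;> simp [ρ, msDir, msDirX, hij]
  · by_cases hij : i = i₁
    · subst hij; simp [ρ, msDir, msDirX]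
    · simp [ρ, msDir, msDirX, hij]
  · by_cases hij : i = i₁
    · subst hij; simp [ρ, msDir, msDirX]
    · simp [ρ, msDir, msDirX, hij]
  · by_cases hi : i = i₁
    · subst hi
      simp [ρ, msDir, msDirX, (castAdd_ne_zIdx i).symm]
    · simp [ρ, msDir, msDirX, hi]

/-- `∂/∂x_{n+1}` after the renaming is the renaming of `∂/∂y_{i₁}`. [folklore] -/
theorem msD_rename_zIdx (Q : MvPolynomial (MsVar n) k) :
    msD k (zIdx n) (rename (ρ i₁) Q) = rename (ρ i₁) (pderiv (MsKind.y, i₁) Q) := by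
  classical
  refine derivation_rename_eq (ρ i₁) _ _ (fun w => ?_) Q
  rw [msD_X, pderiv_X]
  rcases w with ⟨κ, i⟩
  cases κ
  · simp [ρ, msDir, castAdd_ne_zIdx]
  · simp [ρ, msDir, castAdd_ne_zIdx]
  · simp [ρ, msDir, castAdd_ne_zIdx]
  · by_cases hi : i = i₁
    · subst hi; simp [ρ, msDir]
    · simp [ρ, msDir, hi, castAdd_ne_zIdx]

/-- `∂/∂x_{n+2}` kills the renamed elements. [folklore] -/
theorem msD_rename_yIdx (Q : MvPolynomial (MsVar n) k) :
    msD k (yIdx n) (rename (ρ i₁) Q) = 0 := by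
  have := derivation_rename_eq (ρ i₁) (msD k (yIdx n)) 0 (fun w => ?_) Q
  · simpa using this
  rw [msD_X]
  rcases w with ⟨κ, i⟩
  cases κ
  · simp [ρ, msDir, castAdd_ne_yIdx]
  · simp [ρ, msDir, castAdd_ne_yIdx]
  · simp [ρ, msDir, castAdd_ne_yIdx]
  · by_cases hi : i = i₁
    · subst hi; simp [ρ, msDir, zIdx_ne_yIdx]
    · simp [ρ, msDir, hi, castAdd_ne_yIdx]

/-- `∂/∂xⱼ` (old `j`) of a `y`-product: Euler's identity. [folklore] -/
theorem msD_castAdd_yProd (j : Fin n) (T : Finset (Fin n)) (m : Fin n → ℕ) :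
    msD k (Fin.castAdd 2 j) (yProd k T m) =
      (if j ∈ T then ((m j : ℕ) : MvPolynomial (MsVar (n + 2)) k) else 0) * yProd k T m := by
  classical
  rw [yProd, derivation_prod_of_eq (msD k (Fin.castAdd 2 j)) T
    (ε := fun i => ((m i : ℕ) : MvPolynomial (MsVar (n + 2)) k) * if i = j then 1 else 0)]
  · congr 1
    simp [Finset.sum_ite_eq']
  · intro i _
    refine derivation_pow_of_eq _ ?_ _
    rw [msD_X]
    by_cases hij : i = j
    · subst hij; simp [msDir]
    · simp [msDir, hij]

/-- `∂/∂x_{n+1}` kills `y`-products. [folklore] -/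
theorem msD_zIdx_yProd (T : Finset (Fin n)) (m : Fin n → ℕ) : msD k (zIdx n) (yProd k T m) = 0 := by
  classical
  rw [yProd, derivation_prod_of_eq (msD k (zIdx n)) T (ε := fun _ => 0)]
  · simp
  · intro i _
    have := derivation_pow_of_eq (msD k (zIdx n)) (a := (X (MsKind.y, Fin.castAdd 2 i) :
      MvPolynomial (MsVar (n + 2)) k)) (ε := 0) (by simp [msDir, castAdd_ne_zIdx]) (m i)
    simpa using this

/-- `∂/∂x_{n+2}` kills `y`-products. [folklore] -/
theorem msD_yIdx_yProd (T : Finset (Fin n)) (m : Fin n → ℕ) : msD k (yIdx n) (yProd k T m) = 0 := by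
  classical
  rw [yProd, derivation_prod_of_eq (msD k (yIdx n)) T (ε := fun _ => 0)]
  · simp
  · intro i _
    have := derivation_pow_of_eq (msD k (yIdx n)) (a := (X (MsKind.y, Fin.castAdd 2 i) :
      MvPolynomial (MsVar (n + 2)) k)) (ε := 0) (by simp [msDir, castAdd_ne_yIdx]) (m i)
    simpa using this

end Derivatives


section SymbolicDerivatives

variable (s : Finset (Fin n)) (i₁ : Fin n) (ν : Fin n → ℤ) (c : k)

/-- `∂/∂xⱼ` (old `j`) of the left side of (39). [folklore] -/
theorem msD_castAdd_lhsPoly (j : Fin n) :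
    msD k (Fin.castAdd 2 j) (lhsPoly s i₁ ν c) =
      (if j ∈ sPlus s i₁ ν then (((ν j).toNat : ℕ) : MvPolynomial (MsVar (n + 2)) k) else 0) *
        lhsPoly s i₁ ν c := by
  classical
  have hX : msD k (Fin.castAdd 2 j) (X (MsKind.x, zIdx n) ^ (ν i₁).toNat :
      MvPolynomial (MsVar (n + 2)) k) = 0 := by
    have := derivation_pow_of_eq (msD k (Fin.castAdd 2 j)) (a := (X (MsKind.x, zIdx n) :
      MvPolynomial (MsVar (n + 2)) k)) (ε := 0) (by simp [msDir, (castAdd_ne_zIdx j).symm]) (ν i₁).toNat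
    simpa using this
  rw [lhsPoly, Derivation.leibniz, hX, smul_zero, add_zero, smul_eq_mul, Derivation.leibniz, msD_C,
    smul_zero, add_zero, smul_eq_mul, msD_castAdd_yProd]
  ring

/-- `∂/∂x_{n+2}` kills the left side of (39). [folklore] -/
theorem msD_yIdx_lhsPoly : msD k (yIdx n) (lhsPoly s i₁ ν c) = 0 := by
  have hX : msD k (yIdx n) (X (MsKind.x, zIdx n) ^ (ν i₁).toNat : MvPolynomial (MsVar (n + 2)) k) = 0 := by
    have := derivation_pow_of_eq (msD k (yIdx n)) (a := (X (MsKind.x, zIdx n) :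
      MvPolynomial (MsVar (n + 2)) k)) (ε := 0) (by simp [msDir, zIdx_ne_yIdx]) (ν i₁).toNat
    simpa using this
  rw [lhsPoly, Derivation.leibniz, hX, smul_zero, add_zero, smul_eq_mul, Derivation.leibniz, msD_C,
    smul_zero, add_zero, smul_eq_mul, msD_yIdx_yProd, mul_zero, mul_zero]

/-- `∂/∂x_{n+1}` of the left side of (39): `n₁ x_{n+1}^{n₁ - 1} e^c ∏_{s⁺}`. [folklore] -/
theorem msD_zIdx_lhsPoly : msD k (zIdx n) (lhsPoly s i₁ ν c) =
    ((((ν i₁).toNat : ℕ) : MvPolynomial (MsVar (n + 2)) k) * X (MsKind.x, zIdx n) ^ ((ν i₁).toNat - 1)) *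
      (C (exp c) * yProd k (sPlus s i₁ ν) fun j => (ν j).toNat) := by
  have h1 : msD k (zIdx n) (C (exp c) * yProd k (sPlus s i₁ ν) fun j => (ν j).toNat) = 0 := by
    rw [Derivation.leibniz, msD_C, smul_zero, add_zero, smul_eq_mul, msD_zIdx_yProd, mul_zero]
  rw [lhsPoly, Derivation.leibniz, smul_eq_mul, smul_eq_mul, h1, mul_zero, zero_add,
    Derivation.leibniz_pow, msD_X]
  simp [msDir, smul_eq_mul]
  ring

/-- `∂/∂xⱼ` (old `j`) of the right side of (39). [folklore] -/
theorem msD_castAdd_rhsPoly (j : Fin n) :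
    msD k (Fin.castAdd 2 j) (rhsPoly s ν) =
      (if j ∈ sMinus s ν then (((-ν j).toNat : ℕ) : MvPolynomial (MsVar (n + 2)) k) else 0) *
        rhsPoly s ν := by
  classical
  rw [rhsPoly, Derivation.leibniz, smul_eq_mul, smul_eq_mul, msD_castAdd_yProd, msD_X]
  simp [msDir, (castAdd_ne_yIdx j).symm]
  ring

/-- `∂/∂x_{n+1}` kills the right side of (39). [folklore] -/
theorem msD_zIdx_rhsPoly : msD k (zIdx n) (rhsPoly s ν) = 0 := by
  rw [rhsPoly, Derivation.leibniz, smul_eq_mul, smul_eq_mul, msD_zIdx_yProd, msD_X]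
  simp [msDir, zIdx_ne_yIdx.symm]

/-- `∂/∂x_{n+2}` of the right side of (39): `-2 x_{n+2} u²_{n+2} · (v_{n+2} ∏_{s⁻})`. [folklore] -/
theorem msD_yIdx_rhsPoly : msD k (yIdx n) (rhsPoly s ν) =
    (C (-2) * X (MsKind.x, yIdx n) * X (MsKind.u, yIdx n) ^ 2) * rhsPoly s ν := by
  rw [rhsPoly, Derivation.leibniz, smul_eq_mul, smul_eq_mul, msD_yIdx_yProd, msD_X]
  simp [msDir]
  ring

end SymbolicDerivatives

section Jacobian

variable (f : k ↪[Language.orderedExpRing] K) (s : Finset (Fin n)) (P : Fin n → MvPolynomial (MsVar n) k)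
  (i₁ : Fin n) (ν : Fin n → ℤ) (c : k) (α : Fin n → K) (β : K)

/-- **The Jacobian matrix of the new system (37)–(39) at the new point.** [cite: DenBesten2016, proof of Theorem 6.1.2] -/
def newJac : Matrix (Fin (n + 2)) (Fin (n + 2)) K :=
  Matrix.of fun i' j' => msEval f (newPt α i₁ β) (msD k j' (newSys s P i₁ ν c i'))

/-- Entries: old rows, old columns. [folklore] -/
theorem newJac_castAdd_castAdd (i j : Fin n) :
    newJac f s P i₁ ν c α β (Fin.castAdd 2 i) (Fin.castAdd 2 j) =
      msEval f α (msD k j (P i)) -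
        if j = i₁ then exp (α i₁) * msEval f α (pderiv (MsKind.y, i₁) (P i)) else 0 := by
  rw [newJac, Matrix.of_apply, newSys_castAdd]
  by_cases hj : j = i₁
  · subst hj
    rw [msD_rename_castAdd_self, msEval_newPt_rename, if_pos rfl, msD_eq_msDX_add, _root_.map_add,
      _root_.map_mul, msEval_X, msVal_y]
    ring
  · rw [msD_rename_castAdd_of_ne i₁ hj, msEval_newPt_rename, if_neg hj, sub_zero]

/-- Entries: old rows, column `n + 1`. [folklore] -/
theorem newJac_castAdd_zIdx (i : Fin n) :
    newJac f s P i₁ ν c α β (Fin.castAdd 2 i) (zIdx n) = msEval f α (pderiv (MsKind.y, i₁) (P i)) := by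
  rw [newJac, Matrix.of_apply, newSys_castAdd, msD_rename_zIdx, msEval_newPt_rename]

/-- Entries: old rows, column `n + 2`. [folklore] -/
theorem newJac_castAdd_yIdx (i : Fin n) :
    newJac f s P i₁ ν c α β (Fin.castAdd 2 i) (yIdx n) = 0 := by
  rw [newJac, Matrix.of_apply, newSys_castAdd, msD_rename_yIdx, _root_.map_zero]

/-- Entries: row `n + 1` (equation (38)), old columns. [folklore] -/
theorem newJac_zIdx_castAdd (j : Fin n) :
    newJac f s P i₁ ν c α β (zIdx n) (Fin.castAdd 2 j) = -(ν j : K) := by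
  classical
  rw [newJac, Matrix.of_apply, newSys_zIdx, relPoly]
  simp [map_sum, Derivation.leibniz, msDir, (castAdd_ne_yIdx j).symm, Finset.sum_ite_eq']

/-- Entries: row `n + 1`, column `n + 1`. [folklore] -/
theorem newJac_zIdx_zIdx : newJac f s P i₁ ν c α β (zIdx n) (zIdx n) = 0 := by
  classical
  rw [newJac, Matrix.of_apply, newSys_zIdx, relPoly]
  simp [map_sum, Derivation.leibniz, msDir, zIdx_ne_yIdx.symm, castAdd_ne_zIdx]

/-- Entries: row `n + 1`, column `n + 2`. [folklore] -/
theorem newJac_zIdx_yIdx :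
    newJac f s P i₁ ν c α β (zIdx n) (yIdx n) = -(2 * β * ((1 + β ^ 2)⁻¹) ^ 2) := by
  classical
  rw [newJac, Matrix.of_apply, newSys_zIdx, relPoly]
  simp [map_sum, Derivation.leibniz, msDir, castAdd_ne_yIdx]

/-- Entries: row `n + 2` (equation (39)), old columns. [folklore] -/
theorem newJac_yIdx_castAdd (j : Fin n) :
    newJac f s P i₁ ν c α β (yIdx n) (Fin.castAdd 2 j) =
      (if j ∈ sPlus s i₁ ν then ((ν j).toNat : K) else 0) * msEval f (newPt α i₁ β) (lhsPoly s i₁ ν c) -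
        (if j ∈ sMinus s ν then ((-ν j).toNat : K) else 0) * msEval f (newPt α i₁ β) (rhsPoly s ν) := by
  classical
  rw [newJac, Matrix.of_apply, newSys_yIdx, expPoly, _root_.map_sub, _root_.map_sub,
    msD_castAdd_lhsPoly, msD_castAdd_rhsPoly, _root_.map_mul, _root_.map_mul]
  congr 2
  · split_ifs <;> simp
  · split_ifs <;> simp

/-- Entries: row `n + 2`, column `n + 1` (multiplied by `exp(α_{i₁})`, the value of `x_{n+1}`). [folklore] -/
theorem exp_mul_newJac_yIdx_zIdx (hpos : 0 < ν i₁) :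
    exp (α i₁) * newJac f s P i₁ ν c α β (yIdx n) (zIdx n) =
      (ν i₁ : K) * msEval f (newPt α i₁ β) (lhsPoly s i₁ ν c) := by
  have hm : (ν i₁).toNat ≠ 0 := by
    intro h; rw [Int.toNat_eq_zero] at h; exact absurd hpos (not_lt.2 h)
  have hcast : (((ν i₁).toNat : ℕ) : K) = (ν i₁ : K) := by exact_mod_cast Int.toNat_of_nonneg hpos.le
  rw [newJac, Matrix.of_apply, newSys_yIdx, expPoly, _root_.map_sub, msD_zIdx_lhsPoly, msD_zIdx_rhsPoly,
    sub_zero, msEval_lhsPoly, _root_.map_mul, _root_.map_mul, _root_.map_mul]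
  simp only [map_natCast, _root_.map_pow, msEval_X, msVal_x, newPt_zIdx, msEval_C, map_exp, msEval_yProd]
  rw [hcast, ← mul_pow_sub_one hm (exp (α i₁))]
  ring

/-- Entries: row `n + 2`, column `n + 2`. [folklore] -/
theorem newJac_yIdx_yIdx :
    newJac f s P i₁ ν c α β (yIdx n) (yIdx n) =
      2 * β * ((1 + β ^ 2)⁻¹) ^ 2 * msEval f (newPt α i₁ β) (rhsPoly s ν) := by
  rw [newJac, Matrix.of_apply, newSys_yIdx, expPoly, _root_.map_sub, msD_yIdx_lhsPoly, msD_yIdx_rhsPoly,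
    zero_sub, _root_.map_neg, _root_.map_mul, msEval_rhsPoly]
  simp

/-- The integer coefficients of row `n + 2` minus those of row `n + 1`. [folklore] -/
theorem coeff_sub_eq (hν0 : ∀ i, i ∉ s → ν i = 0) (hpos : 0 < ν i₁) (j : Fin n) :
    (if j ∈ sPlus s i₁ ν then ((ν j).toNat : K) else 0) - (if j ∈ sMinus s ν then ((-ν j).toNat : K) else 0) -
        (ν j : K) = if j = i₁ then -(ν i₁ : K) else 0 := by
  by_cases hj : j = i₁
  · subst hj
    have h1 : j ∉ sPlus s j ν := by simp [sPlus]
    have h2 : j ∉ sMinus s ν := by simp [sMinus]; intro _; omega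
    simp [h1, h2]
  · rw [if_neg hj]
    by_cases hjs : j ∈ s
    · rcases lt_trichotomy (ν j) 0 with hlt | heq | hgt
      · have h1 : j ∉ sPlus s i₁ ν := by simp [sPlus]; intro _ _; omega
        have h2 : j ∈ sMinus s ν := by simp [sMinus, hjs, hlt]
        have hc : (((-ν j).toNat : ℕ) : K) = -(ν j : K) := by
          have : (((-ν j).toNat : ℕ) : ℤ) = -ν j := Int.toNat_of_nonneg (by omega)
          exact_mod_cast this
        rw [if_neg h1, if_pos h2, hc]; ring
      · have h1 : j ∉ sPlus s i₁ ν := by simp [sPlus]; intro _ _; omega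
        have h2 : j ∉ sMinus s ν := by simp [sMinus]; intro _; omega
        simp [h1, h2, heq]
      · have h1 : j ∈ sPlus s i₁ ν := by simp [sPlus, hjs, hj, hgt]
        have h2 : j ∉ sMinus s ν := by simp [sMinus]; intro _; omega
        have hc : (((ν j).toNat : ℕ) : K) = (ν j : K) := by exact_mod_cast Int.toNat_of_nonneg hgt.le
        rw [if_pos h1, if_neg h2, hc]; ring
    · have h0 : ν j = 0 := hν0 j hjs
      have h1 : j ∉ sPlus s i₁ ν := by simp [sPlus, hjs]
      have h2 : j ∉ sMinus s ν := by simp [sMinus, hjs]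
      simp [h1, h2, h0]

variable {f s P i₁ ν c α β} in
/-- **The new system is non-singular at the new point** (den Besten obtains this from the
isolation of the point via Proposition 6.2.7 (i), (ii); here directly: a kernel vector `w` of
the Jacobian has `w_{n+1} = exp(α_{i₁}) w_{i₁}` by rows `n + 1`, `n + 2`, whence
`J(f₁, …, fₙ)(ᾱ) (w₁, …, wₙ) = 0`). [cite: DenBesten2016, proof of Theorem 6.1.2] -/
theorem det_newJac_ne_zero (h : IsMsZero f s P α) (hν0 : ∀ i, i ∉ s → ν i = 0)
    (hpos : 0 < ν i₁) (hβpos : 0 < β) (hβ : (1 + β ^ 2)⁻¹ = f c + ∑ i, (ν i : K) * α i) :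
    (newJac f s P i₁ ν c α β).det ≠ 0 := by
  classical
  intro hdet
  obtain ⟨w, hw0, hw⟩ := Matrix.exists_mulVec_eq_zero_iff.2 hdet
  obtain ⟨A, hA⟩ : ∃ A, msEval f (newPt α i₁ β) (lhsPoly s i₁ ν c) = A := ⟨_, rfl⟩
  have hB : msEval f (newPt α i₁ β) (rhsPoly s ν) = A :=
    (msEval_lhsPoly_eq_rhsPoly f c α β hν0 hpos hβ).symm.trans hA
  obtain ⟨ω, hω⟩ : ∃ ω : K, 2 * β * ((1 + β ^ 2)⁻¹) ^ 2 = ω := ⟨_, rfl⟩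
  have hω0 : ω ≠ 0 := by rw [← hω]; positivity
  have hA0 : A ≠ 0 := by
    rw [← hA, msEval_lhsPoly]
    refine mul_ne_zero (pow_ne_zero _ (exp_ne_zero _)) (mul_ne_zero (exp_ne_zero _) ?_)
    exact Finset.prod_ne_zero_iff.2 fun j _ => pow_ne_zero _ (exp_ne_zero _)
  have hy0 : exp (α i₁) ≠ 0 := exp_ne_zero _
  have hν : (ν i₁ : K) ≠ 0 := by exact_mod_cast hpos.ne'
  -- the rows of `M w = 0`
  have row : ∀ i', ∑ j : Fin n, newJac f s P i₁ ν c α β i' (Fin.castAdd 2 j) * w (Fin.castAdd 2 j) +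
      newJac f s P i₁ ν c α β i' (zIdx n) * w (zIdx n) +
        newJac f s P i₁ ν c α β i' (yIdx n) * w (yIdx n) = 0 := by
    intro i'
    have := congrFun hw i'
    rw [Matrix.mulVec, dotProduct, Fin.sum_univ_add, Fin.sum_univ_two, natAdd_zero_eq_zIdx,
      natAdd_one_eq_yIdx, Pi.zero_apply] at this
    rw [← this]; ring
  -- rows `n + 1` and `n + 2`
  have R1 := row (zIdx n)
  simp only [newJac_zIdx_castAdd, newJac_zIdx_zIdx, newJac_zIdx_yIdx, hω] at R1
  have R2 := row (yIdx n)
  simp only [newJac_yIdx_castAdd, newJac_yIdx_yIdx, hA, hB, hω] at R2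
  have Rbz := exp_mul_newJac_yIdx_zIdx f s P i₁ ν c α β hpos
  rw [hA] at Rbz
  -- the sum identity `A · Σ (-nⱼ) wⱼ + Σ (cⱼ A) wⱼ = -n_{i₁} A w_{i₁}`
  have hS : A * ∑ j : Fin n, -(ν j : K) * w (Fin.castAdd 2 j) +
      ∑ j : Fin n, ((if j ∈ sPlus s i₁ ν then ((ν j).toNat : K) else 0) * A -
        (if j ∈ sMinus s ν then ((-ν j).toNat : K) else 0) * A) * w (Fin.castAdd 2 j) =
      -(ν i₁ : K) * A * w (Fin.castAdd 2 i₁) := by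
    rw [Finset.mul_sum, ← Finset.sum_add_distrib]
    have : ∀ j, A * (-(ν j : K) * w (Fin.castAdd 2 j)) +
        ((if j ∈ sPlus s i₁ ν then ((ν j).toNat : K) else 0) * A -
          (if j ∈ sMinus s ν then ((-ν j).toNat : K) else 0) * A) * w (Fin.castAdd 2 j) =
        if j = i₁ then -(ν i₁ : K) * A * w (Fin.castAdd 2 i₁) else 0 := by
      intro j
      have hc := coeff_sub_eq (K := K) s i₁ ν hν0 hpos j
      by_cases hj : j = i₁
      · subst hj; rw [if_pos rfl] at hc ⊢; linear_combination (A * w (Fin.castAdd 2 j)) * hc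
      · rw [if_neg hj] at hc ⊢; linear_combination (A * w (Fin.castAdd 2 j)) * hc
    rw [Finset.sum_congr rfl fun j _ => this j, Finset.sum_ite_eq']
    simp
  -- step 1: `w_{n+1} = exp(α_{i₁}) w_{i₁}`
  have hwz : w (zIdx n) = exp (α i₁) * w (Fin.castAdd 2 i₁) := by
    have h1 : newJac f s P i₁ ν c α β (yIdx n) (zIdx n) * w (zIdx n) =
        (ν i₁ : K) * A * w (Fin.castAdd 2 i₁) := by
      linear_combination A * R1 + R2 - hS
    have h2 : (ν i₁ : K) * A * (w (zIdx n) - exp (α i₁) * w (Fin.castAdd 2 i₁)) = 0 := by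
      linear_combination exp (α i₁) * h1 - w (zIdx n) * Rbz
    have h3 := (mul_eq_zero.1 h2).resolve_left (mul_ne_zero hν hA0)
    linear_combination h3
  -- step 2: `J(f)(ᾱ) w₀ = 0`
  have hJw : ∀ i, ∑ j : Fin n, msEval f α (msD k j (P i)) * w (Fin.castAdd 2 j) = 0 := by
    intro i
    have hr := row (Fin.castAdd 2 i)
    simp only [newJac_castAdd_castAdd, newJac_castAdd_zIdx, newJac_castAdd_yIdx] at hr
    have hsplit : ∑ j : Fin n, (msEval f α (msD k j (P i)) -
        if j = i₁ then exp (α i₁) * msEval f α (pderiv (MsKind.y, i₁) (P i)) else 0) * w (Fin.castAdd 2 j) =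
        ∑ j : Fin n, msEval f α (msD k j (P i)) * w (Fin.castAdd 2 j) -
          exp (α i₁) * msEval f α (pderiv (MsKind.y, i₁) (P i)) * w (Fin.castAdd 2 i₁) := by
      simp [sub_mul, Finset.sum_sub_distrib, ite_mul, Finset.sum_ite_eq']
    linear_combination hr - hsplit - msEval f α (pderiv (MsKind.y, i₁) (P i)) * hwz
  have hw₀ : (fun j => w (Fin.castAdd 2 j)) = 0 := by
    by_contra hne
    refine h.2.2 (Matrix.exists_mulVec_eq_zero_iff.1 ⟨_, hne, ?_⟩)
    funext i
    rw [Matrix.mulVec, dotProduct]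
    simpa using hJw i
  have hwi : ∀ j, w (Fin.castAdd 2 j) = 0 := fun j => congrFun hw₀ j
  -- step 3: the two new coordinates
  have hwz0 : w (zIdx n) = 0 := by rw [hwz, hwi, mul_zero]
  have hwy0 : w (yIdx n) = 0 := by
    simp only [hwi, mul_zero, Finset.sum_const_zero, zero_add, hwz0] at R1
    exact (mul_eq_zero.1 R1).resolve_left (neg_ne_zero.2 hω0)
  -- so `w = 0`
  apply hw0
  funext j'
  refine Fin.addCases (fun i => ?_) (fun t => ?_) j'
  · exact hwi i
  · fin_cases t
    · simpa using hwz0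
    · simpa using hwy0

end Jacobian


section Step

variable {f : k ↪[Language.orderedExpRing] K} {s : Finset (Fin n)} {P : Fin n → MvPolynomial (MsVar n) k}
  {i₁ : Fin n} {ν : Fin n → ℤ} {c : k} {α : Fin n → K}

/-- **The induction step** (Wilkie 1996, pp. 1084–1085; den Besten, pp. 75–77): from a
non-singular zero `ᾱ` of a square system from `Mˢₙ` and a relation `0 < c + Σ_{i ∈ s} nᵢ αᵢ < 1`
with `n_{i₁} > 0`, the point `(ᾱ, exp(α_{i₁}), β)`, `β > 0`, `(1 + β²)⁻¹ = c + Σ nᵢ αᵢ`, is a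
non-singular zero of the square system (37)–(39) from `M^{s ∖ {i₁}}_{n+2}`. [cite: WilkieJAMS1996, §9, pp. 1084–1085] -/
theorem isMsZero_newSys (h : IsMsZero f s P α) (hν0 : ∀ i, i ∉ s → ν i = 0) (hpos : 0 < ν i₁)
    (ht0 : 0 < f c + ∑ i, (ν i : K) * α i) (ht1 : f c + ∑ i, (ν i : K) * α i < 1) :
    ∃ β : K, IsMsZero f (newS s i₁) (newSys s P i₁ ν c) (newPt α i₁ β) := by
  classical
  obtain ⟨t, ht⟩ : ∃ t, f c + ∑ i, (ν i : K) * α i = t := ⟨_, rfl⟩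
  rw [ht] at ht0 ht1
  -- `β > 0` with `1 + β² = t⁻¹`
  have ht' : 0 ≤ t⁻¹ - 1 := by
    rw [sub_nonneg]
    exact (one_le_inv₀ ht0).2 ht1.le
  obtain ⟨β₀, hβ₀⟩ := exists_mul_self_eq ht'
  have hβ₀0 : β₀ ≠ 0 := by
    rintro rfl
    have : t⁻¹ = 1 := by linarith [mul_zero (0 : K)]
    rw [inv_eq_one] at this
    exact absurd ht1 (by rw [this]; exact lt_irrefl 1)
  set β : K := |β₀| with hβdef
  have hβpos : 0 < β := abs_pos.2 hβ₀0
  have hβ : (1 + β ^ 2)⁻¹ = f c + ∑ i, (ν i : K) * α i := by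
    rw [ht, hβdef, sq_abs, sq, hβ₀, add_sub_cancel, inv_inv]
  refine ⟨β, fun i' => ?_, fun i' => ?_, det_newJac_ne_zero h hν0 hpos hβpos hβ⟩
  · obtain ⟨x, rfl⟩ := finSumFinEquiv.surjective i'
    rcases x with i | b
    · rw [finSumFinEquiv_apply_left, newSys_castAdd]
      exact msSupported_rename s i₁ (h.1 i)
    · fin_cases b
      · simpa using msSupported_relPoly (k := k) s i₁ ν c
      · simpa using msSupported_expPoly (k := k) s i₁ ν c hpos
  · obtain ⟨x, rfl⟩ := finSumFinEquiv.surjective i'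
    rcases x with i | b
    · rw [finSumFinEquiv_apply_left, newSys_castAdd, msEval_newPt_rename]
      exact h.2.1 i
    · fin_cases b
      · simpa using msEval_relPoly f i₁ ν c α β hβ
      · simpa using msEval_expPoly f c α β hν0 hpos hβ

end Step

end MsStep

/-! ### The induction: boundedness of `Mˢ`-points from 9.3 -/

section Induction

variable (f : k ↪[Language.orderedExpRing] K)

/-- `f` on differences. [folklore] -/
theorem map_sub'' (a b : k) : f (a - b) = f a - f b := by
  rw [sub_eq_add_neg, RealExpModel.map_add, RealExpModel.map_neg, sub_eq_add_neg]

/-- **Wilkie 1996, §9: every coordinate of a non-singular zero of a square system from `Mˢₙ`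
over `k` is bounded in absolute value by an element of `k`, for a pair `k ⊆ K` of models of
`T_exp` satisfying 9.3** (the hypothesis `h93`: Wilkie 1996, 9.3, p. 1084 = den Besten's
condition (36) / Lemma 7.2.4 — "there exist `nᵢ ∈ ℤ` for `i ∈ s`, not all zero, and `c ∈ k`
such that `0 < c + Σ_{i ∈ s} nᵢ αᵢ < 1`" whenever `ᾱ` is a non-singular zero of a square system
from `Mˢₙ`, `l ∈ s` and `|α_l| > b` for all `b ∈ k`).  Proof: induction on `|s|` for
configurations with `l ∈ s` (pp. 1084–1085): 9.3 gives the relation; if `nᵢ = 0` for all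
`i ≠ l` then `|α_l| < |c| + 1`; otherwise the step `RealExpModel.MsStep.isMsZero_newSys` yields a
configuration with `|s| - 1` exponentials and the same unbounded coordinate. [cite: WilkieJAMS1996, §9, pp. 1083–1085] -/
theorem exists_abs_lt_of_isMsZero_of_lemma93
    (h93 : ∀ (n : ℕ) (s : Finset (Fin n)) (P : Fin n → MvPolynomial (MsVar n) k) (α : Fin n → K),
      IsMsZero f s P α → ∀ l ∈ s, (∀ b : k, f b < |α l|) →
        ∃ (ν : Fin n → ℤ) (c : k), (∀ i, i ∉ s → ν i = 0) ∧ (∃ i, ν i ≠ 0) ∧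
          0 < f c + ∑ i, (ν i : K) * α i ∧ f c + ∑ i, (ν i : K) * α i < 1)
    {n : ℕ} {s : Finset (Fin n)} {P : Fin n → MvPolynomial (MsVar n) k} {α : Fin n → K}
    (h : IsMsZero f s P α) (l : Fin n) : ∃ b : k, |α l| < f b := by
  classical
  suffices key : ∀ (m n : ℕ) (s : Finset (Fin n)) (P : Fin n → MvPolynomial (MsVar n) k) (α : Fin n → K),
      s.card = m → IsMsZero f s P α → ∀ l ∈ s, ∃ b : k, |α l| < f b by
    exact key _ n (insert l s) P α rfl (h.mono f (Finset.subset_insert l s)) l (Finset.mem_insert_self l s)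
  intro m
  induction m with
  | zero =>
    intro n s P α hs _ l hl
    rw [Finset.card_eq_zero] at hs
    subst hs
    simp at hl
  | succ m ih =>
    intro n s P α hs h l hl
    by_contra hcon
    push Not at hcon
    have hlt : ∀ b : k, f b < |α l| := fun b =>
      lt_of_lt_of_le ((map_lt_iff f b (b + 1)).2 (lt_add_one b)) (hcon (b + 1))
    obtain ⟨ν, c, hν0, ⟨i₀, hi₀⟩, ht0, ht1⟩ := h93 n s P α h l hl hlt
    by_cases hA : ∀ i, i ≠ l → ν i = 0
    · -- only `n_l ≠ 0`: then `α_l` is bounded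
      have hνl : ν l ≠ 0 := by
        intro h0
        by_cases hil : i₀ = l
        · exact hi₀ (hil ▸ h0)
        · exact hi₀ (hA i₀ hil)
      have hsum : ∑ i, (ν i : K) * α i = (ν l : K) * α l :=
        Finset.sum_eq_single l (fun i _ hi => by rw [hA i hi]; simp) (by simp)
      rw [hsum] at ht0 ht1
      have h1 : (1 : K) ≤ |(ν l : K)| := by exact_mod_cast Int.one_le_abs hνl
      have h2 : |(ν l : K) * α l| < |f c| + 1 := by
        rw [abs_lt]
        constructor <;> linarith [neg_abs_le (f c), le_abs_self (f c)]
      have h3 : |α l| < |f c| + 1 :=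
        calc |α l| ≤ |(ν l : K)| * |α l| := le_mul_of_one_le_left (abs_nonneg _) h1
          _ = |(ν l : K) * α l| := (abs_mul _ _).symm
          _ < |f c| + 1 := h2
      have h4 : f (|c| + 1) = |f c| + 1 := by rw [RealExpModel.map_add, RealExpModel.map_one, map_abs']
      exact absurd (h4 ▸ hcon (|c| + 1)) (not_le.2 h3)
    · -- some `n_{i₁} ≠ 0`, `i₁ ≠ l`: the step, and the inductive hypothesis
      push Not at hA
      obtain ⟨i₁, hi₁l, hνi₁⟩ := hA
      have hi₁s : i₁ ∈ s := by
        by_contra h'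
        exact hνi₁ (hν0 i₁ h')
      have main : ∀ (ν : Fin n → ℤ) (c : k), (∀ i, i ∉ s → ν i = 0) → 0 < ν i₁ →
          0 < f c + ∑ i, (ν i : K) * α i → f c + ∑ i, (ν i : K) * α i < 1 → ∃ b : k, |α l| < f b := by
        intro ν c hν0 hpos ht0 ht1
        obtain ⟨β, hβ⟩ := MsStep.isMsZero_newSys h hν0 hpos ht0 ht1
        have hcard : (MsStep.newS s i₁).card = m := by
          rw [MsStep.card_newS s i₁ hi₁s, hs, Nat.add_sub_cancel]
        obtain ⟨b, hb⟩ := ih (n + 2) _ _ _ hcard hβ (Fin.castAdd 2 l)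
          ((MsStep.castAdd_mem_newS s i₁).2 ⟨hl, fun h' => hi₁l h'.symm⟩)
        exact ⟨b, by simpa using hb⟩
      have hnot : ¬ ∃ b : k, |α l| < f b := not_exists.2 fun b => not_lt.2 (hcon b)
      rcases lt_or_gt_of_ne hνi₁ with hneg | hpos
      · refine hnot (main (fun i => -ν i) (1 - c) (fun i hi => by simp [hν0 i hi]) (by simpa using hneg) ?_ ?_)
        · simp only [Int.cast_neg, neg_mul, Finset.sum_neg_distrib, map_sub'', RealExpModel.map_one]
          linarith
        · simp only [Int.cast_neg, neg_mul, Finset.sum_neg_distrib, map_sub'', RealExpModel.map_one]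
          linarith
      · exact hnot (main ν c hν0 hpos ht0 ht1)

end Induction

/-! ### Exponential-polynomial points are `Mˢ`-points with `s = {1, …, n}` -/

section Bridge

variable (f : k ↪[Language.orderedExpRing] K) {n : ℕ}

/-- The generator symbols of `k[x̄, e^{x̄}]` inside those of `Mˢₙ`: `Xᵢ ↦ xᵢ`, `Yᵢ ↦ yᵢ`. [folklore] -/
def msOfXY (n : ℕ) : Fin n ⊕ Fin n → MsVar n :=
  Sum.elim (fun i => (MsKind.x, i)) fun i => (MsKind.y, i)

/-- Evaluating a transported polynomial: `P(x̄, e^{x̄})`. [folklore] -/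
theorem msEval_rename_msOfXY (α : Fin n → K) (Q : MvPolynomial (Fin n ⊕ Fin n) k) :
    msEval f α (rename (msOfXY n) Q) = eval₂Hom (toRingHom f) (Sum.elim α fun i => exp (α i)) Q := by
  have h : msVal α ∘ msOfXY n = Sum.elim α fun i => exp (α i) := by
    funext v; rcases v with i | i <;> rfl
  rw [msEval, eval₂Hom_rename, h]

/-- The exponential term of a polynomial realizes to the value of the transported polynomial. [folklore] -/
theorem realize_expPolyTerm_eq_msEval (α : Fin n → K) (p : Language.orderedRing.Term (k ⊕ (Fin n ⊕ Fin n))) :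
    (expPolyTerm p).realize (Sum.elim (f : k → K) α) = msEval f α (rename (msOfXY n) (mvPolynomialOfTerm p)) := by
  rw [realize_expPolyTerm, msEval_rename_msOfXY, eval₂_mvPolynomialOfTerm]
  rfl

/-- `expPolyTerm` on a sum given by `func` (syntactically). [folklore] -/
theorem expPolyTerm_func_add (ts : Fin 2 → Language.orderedRing.Term (k ⊕ (Fin n ⊕ Fin n))) :
    expPolyTerm (func (ringFunc.add : Language.orderedRing.Functions 2) ts) =
      expPolyTerm (ts 0) + expPolyTerm (ts 1) := by
  change func _ _ = func _ _
  congr 1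
  funext l
  fin_cases l <;> rfl

/-- `expPolyTerm` on a product given by `func` (syntactically). [folklore] -/
theorem expPolyTerm_func_mul (ts : Fin 2 → Language.orderedRing.Term (k ⊕ (Fin n ⊕ Fin n))) :
    expPolyTerm (func (ringFunc.mul : Language.orderedRing.Functions 2) ts) =
      expPolyTerm (ts 0) * expPolyTerm (ts 1) := by
  change func _ _ = func _ _
  congr 1
  funext l
  fin_cases l <;> rfl

/-- `expPolyTerm` on a negation given by `func` (syntactically). [folklore] -/
theorem expPolyTerm_func_neg (ts : Fin 1 → Language.orderedRing.Term (k ⊕ (Fin n ⊕ Fin n))) :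
    expPolyTerm (func (ringFunc.neg : Language.orderedRing.Functions 1) ts) = -expPolyTerm (ts 0) := by
  change func _ _ = func _ _
  congr 1
  funext l
  fin_cases l; rfl

/-- `expPolyTerm` on `0` given by `func` (syntactically). [folklore] -/
theorem expPolyTerm_func_zero (ts : Fin 0 → Language.orderedRing.Term (k ⊕ (Fin n ⊕ Fin n))) :
    expPolyTerm (func (ringFunc.zero : Language.orderedRing.Functions 0) ts) = 0 := by
  change func _ _ = func _ _
  congr 1
  funext l
  exact l.elim0

/-- `expPolyTerm` on `1` given by `func` (syntactically). [folklore] -/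
theorem expPolyTerm_func_one (ts : Fin 0 → Language.orderedRing.Term (k ⊕ (Fin n ⊕ Fin n))) :
    expPolyTerm (func (ringFunc.one : Language.orderedRing.Functions 0) ts) = 1 := by
  change func _ _ = func _ _
  congr 1
  funext l
  exact l.elim0

/-- **The formal Jacobian of an exponential-polynomial system is the `Mˢ`-Jacobian of the
transported polynomials**: `∂/∂xⱼ [p(x̄, e^{x̄})] = (∂_{xⱼ} p + yⱼ ∂_{yⱼ} p)(x̄, e^{x̄})`, i.e. the
formal partial derivative of the term `expPolyTerm p` realizes to the value of
`RealExpModel.msD j` of the transported polynomial. [cite: Wilkie1989, §1, p. 385] -/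
theorem realize_termPDeriv_expPolyTerm (α : Fin n → K) (j : Fin n)
    (p : Language.orderedRing.Term (k ⊕ (Fin n ⊕ Fin n))) :
    (termPDeriv j (expPolyTerm p)).realize (Sum.elim (f : k → K) α) =
      msEval f α (msD k j (rename (msOfXY n) (mvPolynomialOfTerm p))) := by
  classical
  induction p with
  | var v =>
    rcases v with c | i | i
    · simp [expPolyTerm, mvPolynomialOfTerm]
    · by_cases hij : i = j
      · subst hij; simp [expPolyTerm, mvPolynomialOfTerm, msOfXY, msDir]
      · simp [expPolyTerm, mvPolynomialOfTerm, msOfXY, msDir, hij, termPDeriv_var_inr_of_ne]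
    · by_cases hij : i = j
      · subst hij; simp [expPolyTerm, mvPolynomialOfTerm, msOfXY, msDir, Term.subst]
      · simp [expPolyTerm, mvPolynomialOfTerm, msOfXY, msDir, hij, Term.subst, termPDeriv_var_inr_of_ne]
  | func g ts ih =>
    cases g with
    | add =>
      rw [expPolyTerm_func_add, termPDeriv_add, RealExpModel.realize_add, ih 0, ih 1]
      simp only [mvPolynomialOfTerm, _root_.map_add]
    | mul =>
      rw [expPolyTerm_func_mul, termPDeriv_mul, RealExpModel.realize_add,
        RealExpModel.realize_mul, RealExpModel.realize_mul, ih 0, ih 1,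
        realize_expPolyTerm_eq_msEval, realize_expPolyTerm_eq_msEval]
      simp only [mvPolynomialOfTerm, _root_.map_mul, Derivation.leibniz, smul_eq_mul, _root_.map_add]
      ring
    | neg =>
      rw [expPolyTerm_func_neg, termPDeriv_neg, RealExpModel.realize_neg, ih 0]
      simp only [mvPolynomialOfTerm, _root_.map_neg]
    | zero =>
      rw [expPolyTerm_func_zero]
      simp [mvPolynomialOfTerm]
    | one =>
      rw [expPolyTerm_func_one]
      simp [mvPolynomialOfTerm, ExpTerm.termPDeriv_one]

variable {f} in
/-- **A non-singular zero of a square exponential-polynomial system over `k` is a non-singular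
zero of a square system from `M^{{1,…,n}}_n`** (den Besten, Remark 6.2.1: "`ᾱ` is
`(k, σ̄')`-definable, where `σ̄'` is the `(r, r)`-sequence `(exp(x₁), …, exp(x_r))`"). [cite: DenBesten2016, Remark 6.2.1] -/
theorem exists_isMsZero_of_isExpPolynomialPointOver {α : Fin n → K} (hα : IsExpPolynomialPointOver f α) :
    ∃ P : Fin n → MvPolynomial (MsVar n) k, IsMsZero f Finset.univ P α := by
  obtain ⟨p, hp0, hpJ⟩ := hα
  refine ⟨fun i => rename (msOfXY n) (mvPolynomialOfTerm (p i)), fun i w _ _ => Finset.mem_univ _,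
    fun i => ?_, ?_⟩
  · rw [← realize_expPolyTerm_eq_msEval]
    exact hp0 i
  · have : (Matrix.of fun i j => msEval f α (msD k j (rename (msOfXY n) (mvPolynomialOfTerm (p i))))) =
        jacobian (fun i => expPolyTerm (p i)) f α := by
      ext i j
      rw [Matrix.of_apply, jacobian_apply, realize_termPDeriv_expPolyTerm]
    rw [this]
    exact hpJ

/-- **The printed leaf for one pair of models, from 9.3 for that pair**: if `f : k ↪ K` satisfies
9.3 then every non-singular zero of a square exponential-polynomial system over `k` in `Kⁿ` is
bounded in absolute value by an element of `k` (Wilkie 1996, §9, p. 1083, via Remark 6.2.1 of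
den Besten and the induction). [cite: WilkieJAMS1996, §9, pp. 1083–1085] -/
theorem exists_abs_lt_of_isExpPolynomialPointOver_of_lemma93
    (h93 : ∀ (n : ℕ) (s : Finset (Fin n)) (P : Fin n → MvPolynomial (MsVar n) k) (α : Fin n → K),
      IsMsZero f s P α → ∀ l ∈ s, (∀ b : k, f b < |α l|) →
        ∃ (ν : Fin n → ℤ) (c : k), (∀ i, i ∉ s → ν i = 0) ∧ (∃ i, ν i ≠ 0) ∧
          0 < f c + ∑ i, (ν i : K) * α i ∧ f c + ∑ i, (ν i : K) * α i < 1)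
    {α : Fin n → K} (hα : IsExpPolynomialPointOver f α) : ∃ b : k, ∀ i, |α i| < f b := by
  classical
  obtain ⟨P, hP⟩ := exists_isMsZero_of_isExpPolynomialPointOver hα
  have hi : ∀ i, ∃ b : k, |α i| < f b := fun i => exists_abs_lt_of_isMsZero_of_lemma93 f h93 hP i
  choose b hb using hi
  rcases Nat.eq_zero_or_pos n with rfl | hn
  · obtain ⟨z⟩ := (inferInstance : Nonempty k)
    exact ⟨z, fun i => i.elim0⟩
  · haveI : Nonempty (Fin n) := ⟨⟨0, hn⟩⟩
    obtain ⟨i₀, hi₀⟩ := Finite.exists_max b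
    exact ⟨b i₀, fun i => lt_of_lt_of_le (hb i) ((map_le_iff f _ _).2 (hi₀ i))⟩

end Bridge

end RealExpModel

/-! ### The printed leaf and its dependents, from Lemma 9.3 -/

open RealExpModel in
/-- **Wilkie 1996, §9 (pp. 1083–1085): the boundedness of non-singular zeros of
exponential-polynomial systems (`Wilkie1996_expPolynomialPoints_bounded`, the last unproved leaf
under Wilkie's theorem in this tree) follows from 9.3 (p. 1084) alone** — for all pairs of models
`k ⊆ K` of `T_exp`: 9.3 says that if `ᾱ ∈ Kⁿ` is a non-singular zero of a square system from
`Mˢₙ = k[xᵢ, (1 + xᵢ²)⁻¹, e(xᵢ), exp(xᵢ) (i ∈ s)]`, `l ∈ s` and `|α_l| > b` for all `b ∈ k`,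
then `0 < c + Σ_{i ∈ s} nᵢ αᵢ < 1` for some `nᵢ ∈ ℤ` (`i ∈ s`) not all zero and some `c ∈ k`
(den Besten 2016, (36) and Lemma 7.2.4; proved by Wilkie in §§10–11 from the smoothness and
model completeness of `T_e` and the valuation inequality).  The model completeness of `T_e`
(First Main Theorem), which the printed proof also invokes for the case `m = 0` of `(*)ₘ`, is
not needed outside 9.3. [cite: WilkieJAMS1996, §9, pp. 1083–1085] -/
theorem Wilkie1996_expPolynomialPoints_bounded_of_lemma93
    (h93 : ∀ (k K : Language.Theory.ModelType.{0, 0, 0} realExpTheory) (f : k ↪[Language.orderedExpRing] K)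
      (n : ℕ) (s : Finset (Fin n)) (P : Fin n → MvPolynomial (MsVar n) k) (α : Fin n → K),
      IsMsZero f s P α → ∀ l ∈ s, (∀ b : k, f b < |α l|) →
        ∃ (ν : Fin n → ℤ) (c : k), (∀ i, i ∉ s → ν i = 0) ∧ (∃ i, ν i ≠ 0) ∧
          0 < f c + ∑ i, (ν i : K) * α i ∧ f c + ∑ i, (ν i : K) * α i < 1) :
    Wilkie1996_expPolynomialPoints_bounded := fun k K f _ _ hα =>
  exists_abs_lt_of_isExpPolynomialPointOver_of_lemma93 f (h93 k K f) hα

open RealExpModel in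
/-- **The hypothesis of Wilkie 1989, Theorem 2, for all models** (`Wilkie1996_expAlgebraicPoints_bounded`:
every exponential-algebraic point over a submodel is bounded over it) **from 9.3**, through the
unravelling of nested exponentials (`Wilkie1996_expAlgebraicPoints_bounded_iff`). [cite: WilkieJAMS1996, §9, p. 1083] -/
theorem Wilkie1996_expAlgebraicPoints_bounded_of_lemma93
    (h93 : ∀ (k K : Language.Theory.ModelType.{0, 0, 0} realExpTheory) (f : k ↪[Language.orderedExpRing] K)
      (n : ℕ) (s : Finset (Fin n)) (P : Fin n → MvPolynomial (MsVar n) k) (α : Fin n → K),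
      IsMsZero f s P α → ∀ l ∈ s, (∀ b : k, f b < |α l|) →
        ∃ (ν : Fin n → ℤ) (c : k), (∀ i, i ∉ s → ν i = 0) ∧ (∃ i, ν i ≠ 0) ∧
          0 < f c + ∑ i, (ν i : K) * α i ∧ f c + ∑ i, (ν i : K) * α i < 1) :
    Wilkie1996_expAlgebraicPoints_bounded :=
  Wilkie1996_expAlgebraicPoints_bounded_iff.2 (Wilkie1996_expPolynomialPoints_bounded_of_lemma93 h93)

open RealExpModel in
/-- **Wilkie's theorem from 9.3**: the model completeness of `T_exp` (`wilkie_isModelComplete`)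
now rests on Lemma 9.3 alone (the 1989 leaf `Wilkie1989_expAlgebraicPoints_mem` being proved in
`Wilkie1989StepsAB.lean`). [cite: WilkieJAMS1996, Second Main Theorem and §9] -/
theorem wilkie_isModelComplete_of_lemma93
    (h93 : ∀ (k K : Language.Theory.ModelType.{0, 0, 0} realExpTheory) (f : k ↪[Language.orderedExpRing] K)
      (n : ℕ) (s : Finset (Fin n)) (P : Fin n → MvPolynomial (MsVar n) k) (α : Fin n → K),
      IsMsZero f s P α → ∀ l ∈ s, (∀ b : k, f b < |α l|) →
        ∃ (ν : Fin n → ℤ) (c : k), (∀ i, i ∉ s → ν i = 0) ∧ (∃ i, ν i ≠ 0) ∧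
          0 < f c + ∑ i, (ν i : K) * α i ∧ f c + ∑ i, (ν i : K) * α i < 1) :
    wilkie_isModelComplete :=
  wilkie_isModelComplete_of_expPolynomialPoints_bounded (Wilkie1996_expPolynomialPoints_bounded_of_lemma93 h93)

open RealExpModel in
/-- **O-minimality of `ℝ_exp` from 9.3** (`wilkie_isOMinimal`, through
`wilkie_isOMinimal_of_expPolynomialPoints_bounded` of `RealExpOMinimalProofs.lean`, where
Khovanskii's hypothesis is proved). [cite: WilkieJAMS1996, Second Main Theorem and §9] -/
theorem wilkie_isOMinimal_of_lemma93
    (h93 : ∀ (k K : Language.Theory.ModelType.{0, 0, 0} realExpTheory) (f : k ↪[Language.orderedExpRing] K)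
      (n : ℕ) (s : Finset (Fin n)) (P : Fin n → MvPolynomial (MsVar n) k) (α : Fin n → K),
      IsMsZero f s P α → ∀ l ∈ s, (∀ b : k, f b < |α l|) →
        ∃ (ν : Fin n → ℤ) (c : k), (∀ i, i ∉ s → ν i = 0) ∧ (∃ i, ν i ≠ 0) ∧
          0 < f c + ∑ i, (ν i : K) * α i ∧ f c + ∑ i, (ν i : K) * α i < 1) :
    wilkie_isOMinimal :=
  wilkie_isOMinimal_of_expPolynomialPoints_bounded (Wilkie1996_expPolynomialPoints_bounded_of_lemma93 h93)

end Literature.ModelTheory.ExponentialFields
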